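import Summits.MatrixMultiplication.MatrixMultiplication.Theorems.ObstructionDescentGenericRankEngine
import Summits.MatrixMultiplication.MatrixMultiplication.Theorems.ObstructionDescentDominance

set_option linter.dupNamespace false

/-!
# Obstruction descent — the RESIDUAL of the `P_O` line after the generic-rank engine (decomp-mm · lens 3 · gen 28)

`route-MatrixMultiplication-ObstructionDescent`, crux `NoOccurrenceObstruction` (`P_O`, stmt 29040); NODE-g28 §2.

The line of crux 29040 reads `P_O ⟸ UnitSaturationCore` (g26, `noOccurrenceObstruction_of_core`) `⟺ Core|irr` (g27,
`unitSaturationCore_iff_irreducible`).  This module composes the three normal-form theorems now in the tree into ONE residual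
clause, the statement a prover of 29040 is actually left with — **`FatIrreducibleCore`** (spelled inline, no decl): unit
saturation `HWV_{Λ,d} ≤ I(GL_m³·⟨m⟩) ⟹ HWV_{Λ,d} = 0` is required ONLY for types `Λ` of the core window (`2 < τ < 4`, `d > m`,
`≤ n²` parts per slot, `> m` part-pairs per slot pair) which are moreover

* LIVE (`HWV_{Λ,d} ≠ 0`) — hence, offered as free hypotheses, DOMINANT (every `Λ⁽ˢ⁾` monotone along the Borel order:
  partition triples, g27 `monotone_of_hwvSpace_ne_bot`) and of WEIGHT `Σ_a Λ⁽ˢ⁾_a = d` in every slot (g27 weight law);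
* IRREDUCIBLE (no splitting into two live types of positive degrees, g27);
* UNCERTIFIED: no coordinate set `S ⊇ corner(Λ)` carries a Jacobian certificate of the rank-`m` parametrisation (g28 engine
  `hwvSpace_eq_bot_of_jacobian`) — i.e. the corner box of `Λ` has generic border rank `> m`, which inside the window forces all
  three slots to be fat.

Kernel: `core_irr_of_fatIrreducibleCore` (the residual clause implies the g27 clause `Core|irr`) and, by name,
**`noOccurrenceObstruction_of_fatIrreducibleCore : FatIrreducibleCore ⟹ NoOccurrenceObstruction`**.  No proposition is defined;
no `def`; sorry-free; standard axioms. [cite: BurgisserIkenmeyer2011, §3.1, Prop. 3.3] [cite: LandsbergGCT2017, §2.1.6, §4.7.1, §7.1]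
-/

noncomputable section

open scoped BigOperators
open Finset

namespace Summit.MatrixMultiplication.MatrixMultiplication.Theorems.ObstructionDescentGenericRankEngine

open Literature.Computability.AlgebraicComplexity (unitTensor)
open Summit.MatrixMultiplication.MatrixMultiplication.Theorems.ObstructionCalculus
open Summit.MatrixMultiplication.MatrixMultiplication.Theses.ObstructionDescent
open Summit.MatrixMultiplication.MatrixMultiplication.Theorems.ObstructionDescentIrreducibleTypes
open Summit.MatrixMultiplication.MatrixMultiplication.Theorems.ObstructionDescentDominance

/-- **The residual clause implies `Core|irr`.**  Given the saturation clause for live, dominant, irreducible, uncertified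
window types (with the weight law offered as a hypothesis), the g27 clause on all irreducible window types follows: a dead type
(`HWV = 0`) needs nothing, a live one is monotone with slice weights `d` (g27), and a certified one is discharged by the
generic-rank engine (g28). [this node] -/
theorem core_irr_of_fatIrreducibleCore
    (hres : ∀ τ : ℝ, 2 < τ → τ < 4 → ∃ n₀ : ℕ, ∀ n m : ℕ, n₀ ≤ n → n * n ≤ m → (n : ℝ) ^ τ ≤ (m : ℝ) →
      ∀ (Λ : Fin 3 → Fin m → ℕ) (d : ℕ), m < d → (∀ s, (Finset.univ.filter fun a => Λ s a ≠ 0).card ≤ n * n) →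
        m < (Finset.univ.filter fun a => Λ 0 a ≠ 0).card * (Finset.univ.filter fun a => Λ 1 a ≠ 0).card →
        m < (Finset.univ.filter fun a => Λ 0 a ≠ 0).card * (Finset.univ.filter fun a => Λ 2 a ≠ 0).card →
        m < (Finset.univ.filter fun a => Λ 1 a ≠ 0).card * (Finset.univ.filter fun a => Λ 2 a ≠ 0).card →
        (∀ (Λ₁ Λ₂ : Fin 3 → Fin m → ℕ) (d₁ d₂ : ℕ), Λ₁ + Λ₂ = Λ → d₁ + d₂ = d →
            hwvSpace Λ₁ d₁ ≠ ⊥ → hwvSpace Λ₂ d₂ ≠ ⊥ → d₁ = 0 ∨ d₂ = 0) →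
        hwvSpace Λ d ≠ ⊥ → (∀ s, Monotone (Λ s)) → (∀ s, ∑ a, Λ s a = d) →
        (∀ S : Finset (Idx m), (∀ p : Idx m, Λ 0 p.1 ≠ 0 → Λ 1 p.2.1 ≠ 0 → Λ 2 p.2.2 ≠ 0 → p ∈ S) →
          ∀ (c : S → MIdx m) (e : MIdx m → ℂ),
            (Matrix.of fun p q : S => MvPolynomial.eval e (MvPolynomial.pderiv (c q)
              (fromCols (genMat 0) (genMat 1) (genMat 2) (p : Idx m).1 (p : Idx m).2.1 (p : Idx m).2.2))).det = 0) →
          hwvSpace Λ d ≤ orbitVanishing (unitTensor ℂ m) → hwvSpace Λ d = ⊥) :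
    ∀ τ : ℝ, 2 < τ → τ < 4 → ∃ n₀ : ℕ, ∀ n m : ℕ, n₀ ≤ n → n * n ≤ m → (n : ℝ) ^ τ ≤ (m : ℝ) →
      ∀ (Λ : Fin 3 → Fin m → ℕ) (d : ℕ), m < d → (∀ s, (Finset.univ.filter fun a => Λ s a ≠ 0).card ≤ n * n) →
        m < (Finset.univ.filter fun a => Λ 0 a ≠ 0).card * (Finset.univ.filter fun a => Λ 1 a ≠ 0).card →
        m < (Finset.univ.filter fun a => Λ 0 a ≠ 0).card * (Finset.univ.filter fun a => Λ 2 a ≠ 0).card →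
        m < (Finset.univ.filter fun a => Λ 1 a ≠ 0).card * (Finset.univ.filter fun a => Λ 2 a ≠ 0).card →
        (∀ (Λ₁ Λ₂ : Fin 3 → Fin m → ℕ) (d₁ d₂ : ℕ), Λ₁ + Λ₂ = Λ → d₁ + d₂ = d →
            hwvSpace Λ₁ d₁ ≠ ⊥ → hwvSpace Λ₂ d₂ ≠ ⊥ → d₁ = 0 ∨ d₂ = 0) →
          hwvSpace Λ d ≤ orbitVanishing (unitTensor ℂ m) → hwvSpace Λ d = ⊥ := by
  intro τ hτ hτ4
  obtain ⟨n₀, hn₀⟩ := hres τ hτ hτ4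
  refine ⟨n₀, fun n m hn hnm hτm Λ d hd hparts h01 h02 h12 hirr hU => ?_⟩
  by_cases hbot : hwvSpace Λ d = ⊥
  · exact hbot
  by_cases hcert : ∃ S : Finset (Idx m), (∀ p : Idx m, Λ 0 p.1 ≠ 0 → Λ 1 p.2.1 ≠ 0 → Λ 2 p.2.2 ≠ 0 → p ∈ S) ∧
      ∃ (c : S → MIdx m) (e : MIdx m → ℂ),
        (Matrix.of fun p q : S => MvPolynomial.eval e (MvPolynomial.pderiv (c q)
          (fromCols (genMat 0) (genMat 1) (genMat 2) (p : Idx m).1 (p : Idx m).2.1 (p : Idx m).2.2))).det ≠ 0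
  · obtain ⟨S, hS, c, e, hdet⟩ := hcert
    exact hwvSpace_eq_bot_of_jacobian S hS c e hdet hU
  · refine hn₀ n m hn hnm hτm Λ d hd hparts h01 h02 h12 hirr hbot (monotone_of_hwvSpace_ne_bot hbot)
      (sum_eq_degree_of_hwvSpace_ne_bot hbot) (fun S hS c e => ?_) hU
    by_contra hne
    exact hcert ⟨S, hS, c, e, hne⟩

/-- **`FatIrreducibleCore ⟹ NoOccurrenceObstruction`** (the residual of the line of crux 29040 after gens 26–28, by name): unit
saturation for the live, dominant, irreducible, UNCERTIFIED types of the core window implies the occurrence crux `P_O`; every other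
instance of `P_O` is a landed theorem (pad inheritance g26; engines slot-pair / degree g26 and generic-rank g28; reducible types g27;
dead and non-dominant types trivially). [this node] -/
theorem noOccurrenceObstruction_of_fatIrreducibleCore
    (hres : ∀ τ : ℝ, 2 < τ → τ < 4 → ∃ n₀ : ℕ, ∀ n m : ℕ, n₀ ≤ n → n * n ≤ m → (n : ℝ) ^ τ ≤ (m : ℝ) →
      ∀ (Λ : Fin 3 → Fin m → ℕ) (d : ℕ), m < d → (∀ s, (Finset.univ.filter fun a => Λ s a ≠ 0).card ≤ n * n) →
        m < (Finset.univ.filter fun a => Λ 0 a ≠ 0).card * (Finset.univ.filter fun a => Λ 1 a ≠ 0).card →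
        m < (Finset.univ.filter fun a => Λ 0 a ≠ 0).card * (Finset.univ.filter fun a => Λ 2 a ≠ 0).card →
        m < (Finset.univ.filter fun a => Λ 1 a ≠ 0).card * (Finset.univ.filter fun a => Λ 2 a ≠ 0).card →
        (∀ (Λ₁ Λ₂ : Fin 3 → Fin m → ℕ) (d₁ d₂ : ℕ), Λ₁ + Λ₂ = Λ → d₁ + d₂ = d →
            hwvSpace Λ₁ d₁ ≠ ⊥ → hwvSpace Λ₂ d₂ ≠ ⊥ → d₁ = 0 ∨ d₂ = 0) →
        hwvSpace Λ d ≠ ⊥ → (∀ s, Monotone (Λ s)) → (∀ s, ∑ a, Λ s a = d) →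
        (∀ S : Finset (Idx m), (∀ p : Idx m, Λ 0 p.1 ≠ 0 → Λ 1 p.2.1 ≠ 0 → Λ 2 p.2.2 ≠ 0 → p ∈ S) →
          ∀ (c : S → MIdx m) (e : MIdx m → ℂ),
            (Matrix.of fun p q : S => MvPolynomial.eval e (MvPolynomial.pderiv (c q)
              (fromCols (genMat 0) (genMat 1) (genMat 2) (p : Idx m).1 (p : Idx m).2.1 (p : Idx m).2.2))).det = 0) →
          hwvSpace Λ d ≤ orbitVanishing (unitTensor ℂ m) → hwvSpace Λ d = ⊥) :
    NoOccurrenceObstruction :=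
  noOccurrenceObstruction_of_irreducible (core_irr_of_fatIrreducibleCore hres)

end Summit.MatrixMultiplication.MatrixMultiplication.Theorems.ObstructionDescentGenericRankEngine
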